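import Mathlib.Analysis.SpecialFunctions.Pow.Real
import Summits.QuantumFields.BalabanUV.Beta.GAN24.AffineUnroll
import Summits.QuantumFields.BalabanUV.Beta.GAN24.WSlotT2OfPieces

/-!
# `BalabanUV.Beta.GAN24.TowerRateSlavedSocket` — binder row G-an2-4 ∕ (CONV-C), W-slot, the (α-0) parity re-cut, row L11 (Q-L): **THE k₀-WINDOW RATE SOCKET IN
# PREDICATE CURRENCY, CONTRACTION MODULO A SLAVED LONGITUDINAL AMPLITUDE** — the abstract drift twin of MY FILE 1 `LegTowerSlavedRows.good_tower_of_kfold_slaved`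
# (G-an2-4 formalisation swarm, leaf prover `b2b-balaban-gan24-formalise-leaf-03`, gen 67; FILE 4a of the journal INTENT [LEAF03-G67-ONLINE] «(Q-L) LETTER ROWS ⟸
# THE RULED DISPLAY»; over leaf-01's `AffineUnroll` and leaf-10's `WSlotT2OfPieces.exists_geom_dominate`; consumed by FILE 4b `LegTowerSlavedDriftRows`)

NOT IN PRINT; OUR BOOKKEEPING ([folklore] window bookkeeping + two lines of real analysis; 0 `def`, 0 cited facts, 0 `def … : Prop`, 0 sorry).  HONEST FRAMING (cell
contract, verbatim): «discharging `BetaPertH` makes Bałaban's UV stability UNCONDITIONAL — a real constructive-QFT result; it is NOT the continuum limit and NOT the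
Clay problem.»  HONEST DEPENDENCY (verbatim): «continuum YM on T⁴ ⇐ BetaPertH ∧ nine spine estimates (0/9 proved); BetaPertH ⇐ (D1) ∧ (D4) ∧ CAP+tail; G-an2-4
gates asym, D1 and NE2/3/4.»

WHAT (abstract; leaf-01's `AffineUnroll` setting).
* `window_eq` — the k-WINDOW FORM of an affine tower `x (j+1) = A j (x j) + b j` at level `n`:
  `x (n + k) = transport A n k (x n) + Σ_{m<k} transport A (n+m+1) (k−1−m) (b (n+m))`.
* `good_window_rate`, **`good_tower_rate_of_kfold_slaved`** — for a subadditive, monotone size predicate `Good : E → ℝ → Prop`, any `GoodL`, a tower with the window form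
  `x (n+k₀) = Φ n (x n) + S n` on a class `P`: (H1♮) `P X → Good X c → GoodL X g → Good (Φ n X) (θ·c + Cg·g)` (`0 ≤ θ < 1`, `0 ≤ Cg`), (H2d) `Good (S n) (s·μ^n)`,
  (H0) `Good (x i) M` (`i < k₀`), (H3d) `GoodL (x n) (σ·μ^n)` (`0 ≤ μ < 1`) ⟹ `∃ c ϑ, 0 ≤ c ∧ 0 < ϑ < 1 ∧ ∀ n, Good (x n) (c·ϑ^n)` (window induction with
  `ν := max θ μ`: size `M·ν^q + T·q·ν^{q−1}` along `k₀·q + r`, `T := Cg·σ + s`; Bernoulli domination `(m+1)·ν^m ≤ c₀·ϑ₁^m`; `ϑ := ϑ₁^{1/k₀}` by `Real.rpow`).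
Asserts nothing about any table; NEVER «G-an2-4 closed» as (CONV-C); NOT D1, NOT `BetaPertH`, NOT continuum, NOT Clay; not in print.
Unit `b2b-balaban-gan24-formalise-leaf-03` (gen 67), 2026-08-23.
-/

noncomputable section
open Finset
open scoped BigOperators
open Summit.QuantumFields.BalabanUV.Beta.GAN24.AffineUnroll (transport transport_shift eq_transport_add_sum mem_of_rec)
open Summit.QuantumFields.BalabanUV.Beta.GAN24.WSlotT2OfPieces (exists_geom_dominate)

namespace Summit.QuantumFields.BalabanUV.Beta.GAN24.TowerRateSlavedSocket

/-! ## §1 The window form of an affine tower; the k₀-window RATE socket in predicate currency -/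

section Abstract

variable {E : Type*}

/-- [folklore] **THE k-WINDOW FORM OF AN AFFINE TOWER AT LEVEL `n`** (leaf-01's `AffineUnroll.eq_transport_add_sum` on the shifted tower `j ↦ x (j + n)` +
`transport_shift`): `x (n + k) = transport A n k (x n) + Σ_{m<k} transport A (n+m+1) (k−1−m) (b (n+m))`. -/
theorem window_eq [AddCommGroup E] {A : ℕ → E → E} {P : E → Prop} (hP0 : P 0) (hPadd : ∀ x y, P x → P y → P (x + y))
    (hAP : ∀ j x, P x → P (A j x)) (hAadd : ∀ j x y, P x → P y → A j (x + y) = A j x + A j y) {x b : ℕ → E} (hx0 : P (x 0))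
    (hb : ∀ j, P (b j)) (hrec : ∀ j, x (j + 1) = A j (x j) + b j) (n k : ℕ) :
    x (n + k) = transport A n k (x n) + ∑ m ∈ Finset.range k, transport A (n + m + 1) (k - 1 - m) (b (n + m)) := by
  have hxP : ∀ j, P (x j) := mem_of_rec hPadd hAP hx0 hb hrec
  have h := eq_transport_add_sum (A := fun j => A (j + n)) (P := P) (x := fun j => x (j + n)) (b := fun j => b (j + n))
    hP0 hPadd (fun j y hy => hAP (j + n) y hy) (fun j y z hy hz => hAadd (j + n) y z hy hz) (hxP (0 + n))
    (fun j => hb (j + n)) (fun j => by simpa only [Nat.add_right_comm] using hrec (j + n)) k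
  simp only [transport_shift, Nat.zero_add] at h
  rw [Nat.add_comm n k, h]
  congr 1
  refine Finset.sum_congr rfl fun m _ => ?_
  rw [show m + 1 + n = n + m + 1 by omega, Nat.add_comm m n]

/-- [folklore] **THE WINDOW INEQUALITY WITH A GEOMETRIC SOURCE, PREDICATE CURRENCY**: if `Good (x n) c → Good (x (n + k₀)) (θ·c + T·ν^n)` at every level
(`0 ≤ θ ≤ ν ≤ 1`, `0 ≤ T`, `1 ≤ k₀`) and `Good (x i) M` (`0 ≤ M`) on the first window, then along `k₀·q + r` (`r < k₀`) the member has size `M·ν^q + T·q·ν^{q−1}`. -/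
theorem good_window_rate {Good : E → ℝ → Prop} (hGmono : ∀ X c c', c ≤ c' → Good X c → Good X c') {x : ℕ → E} {k₀ : ℕ} (hk : 1 ≤ k₀)
    {θ ν T M : ℝ} (hθ0 : 0 ≤ θ) (hθν : θ ≤ ν) (hν1 : ν ≤ 1) (hT : 0 ≤ T) (hM : 0 ≤ M)
    (hwin : ∀ n c, Good (x n) c → Good (x (n + k₀)) (θ * c + T * ν ^ n)) (H0 : ∀ i, i < k₀ → Good (x i) M) (q r : ℕ) (hr : r < k₀) :
    Good (x (k₀ * q + r)) (M * ν ^ q + T * q * ν ^ (q - 1)) := by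
  have hν0 : 0 ≤ ν := hθ0.trans hθν
  induction q with
  | zero =>
    have e0 : k₀ * 0 + r = r := by simp
    rw [e0]
    refine hGmono _ _ _ (le_of_eq ?_) (H0 r hr)
    simp
  | succ q ih =>
    have e : k₀ * (q + 1) + r = (k₀ * q + r) + k₀ := by ring
    rw [e]
    refine hGmono _ _ _ ?_ (hwin _ _ ih)
    -- θ (M ν^q + T q ν^{q-1}) + T ν^{k₀ q + r} ≤ M ν^{q+1} + T (q+1) ν^q
    have h1 : θ * (M * ν ^ q) ≤ M * ν ^ (q + 1) := by
      rw [pow_succ]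
      nlinarith [pow_nonneg hν0 q, mul_nonneg hM (pow_nonneg hν0 q)]
    have h2 : θ * (T * q * ν ^ (q - 1)) ≤ T * q * ν ^ q := by
      rcases q with _ | q
      · simp
      · rw [Nat.add_sub_cancel, pow_succ]
        have hq : (0 : ℝ) ≤ T * ((q + 1 : ℕ) : ℝ) * ν ^ q := by positivity
        nlinarith
    have h3 : T * ν ^ (k₀ * q + r) ≤ T * ν ^ q := by
      refine mul_le_mul_of_nonneg_left (pow_le_pow_of_le_one hν0 hν1 ?_) hT
      nlinarith
    have e2 : (((q + 1 : ℕ) : ℝ)) = (q : ℝ) + 1 := by push_cast; ring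
    rw [Nat.add_sub_cancel, e2]
    nlinarith

/-- NOT IN PRINT; OUR BOOKKEEPING.  **THE k₀-WINDOW RATE SOCKET IN PREDICATE CURRENCY, CONTRACTION MODULO A SLAVED LONGITUDINAL AMPLITUDE** (the drift twin of MY FILE 1
`LegTowerSlavedRows.good_tower_of_kfold_slaved`).  Data as there: a tower with the window form `x (n + k₀) = Φ n (x n) + S n` on a class `P`; `Good` subadditive and
monotone; `GoodL` arbitrary.  IF (H1♮) `P X → Good X c → GoodL X g → Good (Φ n X) (θ·c + Cg·g)` (`0 ≤ θ < 1`, `0 ≤ Cg`), (H2d) `Good (S n) (s·μ^n)` (`0 ≤ s`,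
`0 ≤ μ < 1`: the window sources DECAY), (H0) `Good (x i) M` (`i < k₀`, `0 ≤ M`), (H3d) `GoodL (x n) (σ·μ^n)` (`0 ≤ σ`: the slaved amplitude DECAYS), THEN the tower
DECAYS: `∃ c ϑ, 0 ≤ c ∧ 0 < ϑ ∧ ϑ < 1 ∧ ∀ n, Good (x n) (c·ϑ^n)`.  Nothing of (H1♮) ∕ (H3d) is claimed here. -/
theorem good_tower_rate_of_kfold_slaved [AddCommMonoid E] {Good GoodL : E → ℝ → Prop} {P : E → Prop}
    (hGadd : ∀ X Y c c', Good X c → Good Y c' → Good (X + Y) (c + c')) (hGmono : ∀ X c c', c ≤ c' → Good X c → Good X c')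
    {x : ℕ → E} {Φ : ℕ → E → E} {S : ℕ → E} {k₀ : ℕ} (hk : 0 < k₀) (hwin : ∀ n, x (n + k₀) = Φ n (x n) + S n) (hxP : ∀ n, P (x n))
    {θ Cg s M σ μ : ℝ} (hθ0 : 0 ≤ θ) (hθ1 : θ < 1) (hCg : 0 ≤ Cg) (hs : 0 ≤ s) (hM : 0 ≤ M) (hσ : 0 ≤ σ) (hμ0 : 0 ≤ μ) (hμ1 : μ < 1)
    (H1 : ∀ n X c g, P X → Good X c → GoodL X g → Good (Φ n X) (θ * c + Cg * g))
    (H2 : ∀ n, Good (S n) (s * μ ^ n)) (H0 : ∀ i, i < k₀ → Good (x i) M) (H3 : ∀ n, GoodL (x n) (σ * μ ^ n)) :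
    ∃ c ϑ : ℝ, 0 ≤ c ∧ 0 < ϑ ∧ ϑ < 1 ∧ ∀ n, Good (x n) (c * ϑ ^ n) := by
  set ν : ℝ := max θ μ with hν
  have hν0 : 0 ≤ ν := le_max_of_le_left hθ0
  have hν1 : ν < 1 := max_lt hθ1 hμ1
  have hθν : θ ≤ ν := le_max_left _ _
  have hμν : μ ≤ ν := le_max_right _ _
  set T : ℝ := Cg * σ + s with hT
  have hT0 : 0 ≤ T := by positivity
  -- the window step with the geometric source `T·ν^n`
  have hstep : ∀ m c, Good (x m) c → Good (x (m + k₀)) (θ * c + T * ν ^ m) := fun m c hc => by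
    rw [hwin m]
    refine hGmono _ _ _ ?_ (hGadd _ _ _ _ (H1 m _ _ _ (hxP m) hc (H3 m)) (H2 m))
    have : μ ^ m ≤ ν ^ m := pow_le_pow_left₀ hμ0 hμν m
    rw [hT]
    nlinarith [pow_nonneg hμ0 m]
  -- Bernoulli domination of the linear factor
  obtain ⟨c₀, ϑ₁, hc₀, hϑ₁0, hϑ₁1, hνϑ₁, hdom⟩ := exists_geom_dominate hν0 hν1
  -- the k₀-th root of ϑ₁
  set ϑ : ℝ := ϑ₁ ^ ((k₀ : ℝ)⁻¹) with hϑ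
  have hk0 : (k₀ : ℝ) ≠ 0 := by exact_mod_cast hk.ne'
  have hϑ0 : 0 < ϑ := Real.rpow_pos_of_pos hϑ₁0 _
  have hϑlt : ϑ < 1 := Real.rpow_lt_one hϑ₁0.le hϑ₁1 (by positivity)
  have hϑpow : ∀ q : ℕ, ϑ ^ (k₀ * q) = ϑ₁ ^ q := fun q => by
    rw [hϑ, ← Real.rpow_natCast, ← Real.rpow_mul hϑ₁0.le, ← Real.rpow_natCast ϑ₁ q]
    congr 1
    push_cast
    field_simp
  have hϑk : 0 < ϑ ^ (k₀ - 1) := pow_pos hϑ0 _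
  refine ⟨(M + T * c₀ * ϑ₁⁻¹) * (ϑ ^ (k₀ - 1))⁻¹, ϑ, by positivity, hϑ0, hϑlt, fun n => ?_⟩
  have hn : n = k₀ * (n / k₀) + n % k₀ := (Nat.div_add_mod n k₀).symm
  set q := n / k₀ with hq
  have hw := good_window_rate hGmono hk hθ0 hθν hν1.le hT0 hM hstep H0 q (n % k₀) (Nat.mod_lt n hk)
  rw [← hn] at hw
  refine hGmono _ _ _ ?_ hw
  -- `M ν^q + T q ν^{q−1} ≤ (M + T c₀ ϑ₁⁻¹) ϑ₁^q ≤ (M + T c₀ ϑ₁⁻¹) (ϑ^{k₀−1})⁻¹ ϑ^n`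
  have hA : M * ν ^ q ≤ M * ϑ₁ ^ q := mul_le_mul_of_nonneg_left (pow_le_pow_left₀ hν0 hνϑ₁ q) hM
  have hB : T * q * ν ^ (q - 1) ≤ T * c₀ * ϑ₁⁻¹ * ϑ₁ ^ q := by
    rcases Nat.eq_zero_or_pos q with h0 | hpos
    · rw [h0]; simp; positivity
    · obtain ⟨p, hp⟩ : ∃ p, q = p + 1 := ⟨q - 1, by omega⟩
      rw [hp, Nat.add_sub_cancel]
      have h1 : ((p : ℝ) + 1) * ν ^ p ≤ c₀ * ϑ₁ ^ p := hdom p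
      have e : T * c₀ * ϑ₁⁻¹ * ϑ₁ ^ (p + 1) = T * (c₀ * ϑ₁ ^ p) := by
        rw [pow_succ]; field_simp
      rw [e, show (T : ℝ) * ((p + 1 : ℕ) : ℝ) * ν ^ p = T * (((p : ℝ) + 1) * ν ^ p) by push_cast; ring]
      exact mul_le_mul_of_nonneg_left h1 hT0
  -- `ϑ₁^q = ϑ^{k₀ q}` and `ϑ^{k₀ q} · ϑ^{k₀−1} ≤ ϑ^n` since `k₀ q + (k₀ − 1) ≥ n`
  have hC : ϑ₁ ^ q ≤ (ϑ ^ (k₀ - 1))⁻¹ * ϑ ^ n := by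
    rw [← hϑpow q, le_inv_mul_iff₀ hϑk, ← pow_add]
    refine pow_le_pow_of_le_one hϑ0.le hϑlt.le ?_
    have := Nat.mod_lt n hk
    omega
  have hMT : 0 ≤ M + T * c₀ * ϑ₁⁻¹ := by positivity
  calc M * ν ^ q + T * ↑q * ν ^ (q - 1) ≤ (M + T * c₀ * ϑ₁⁻¹) * ϑ₁ ^ q := by nlinarith
    _ ≤ (M + T * c₀ * ϑ₁⁻¹) * ((ϑ ^ (k₀ - 1))⁻¹ * ϑ ^ n) := mul_le_mul_of_nonneg_left hC hMT
    _ = (M + T * c₀ * ϑ₁⁻¹) * (ϑ ^ (k₀ - 1))⁻¹ * ϑ ^ n := by ring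

end Abstract

end Summit.QuantumFields.BalabanUV.Beta.GAN24.TowerRateSlavedSocket
end
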